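import Literature.MathematicalPhysics.QuantumFieldTheory.Balaban1983to89.B4Thm110BoxDerivCut
import Literature.MathematicalPhysics.QuantumFieldTheory.Balaban1983to89.B4Thm110BoxUniform
import Literature.MathematicalPhysics.QuantumFieldTheory.Balaban1983to89.B4Thm110BoxDerivRegular

/-!
# `Balaban1983to89.B4Thm110BoxDerivUniform` — [Balaban1983RegularityDecay] THEOREM p. 573, (1.10) DERIVATIVE member on
# a box, HYPOTHESIS-FREE for a (1.7)-regular field constant near `∂Ω`, «e sufficiently small» UNIFORM IN `Ω`
# (the print's cut cubes; discharge of the per-cube inputs of `B4Thm110BoxDerivCut` on the sub-boxes of sides `≤ 2K`)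

statement-level skeleton of published theorems with citation tags; proofs where landed; nothing here is a claim about the Yang–Mills mass gap

CITATION HEADER.  T. Bałaban, *Regularity and decay of lattice Green's functions*, Commun. Math. Phys. **89** (1983)
571–597, doi:10.1007/bf01214744 [Balaban1983RegularityDecay] (cell paper B4; held text
`paper:balaban1983-cmp89-regularity-decay`, journal page = PDF page + 570; pp. 572–573, 575–579, 581).  Unit `lit-balaban-p17`
gen 5 (Phase-2 proof seat p17; HOME `run/shared/lean/pub/lit-balaban/`), SKELETON row **B4.Thm@573** ((1.10) derivative
member, rectangular `Ω`).  Imports p17 g5 `B4Thm110BoxDerivCut` (`thm110_deriv_boxCut_cubeField`), `B4Thm110BoxUniform`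
(`IsInt`, `baseVal`, `regular_shift`, `face_const`) and p17 g4 `B4Thm110BoxDerivRegular` (`const_inputs_deriv`,
`derivA_congr_bonds`; → `B4Thm110BoxRegular.const_inputs`, p35's `B4Eq220CubeField`).

WHAT IS PRINTED.  p. 573: «Similarly |(D^η_{A,μ}G_k(Ω,A)f)(x)|, |(G_k(Ω,A)f)(x)| ≤ c₀ exp(−δ₀ dist(x, supp f))‖f‖_∞ (1.10)
… [constants] independent of A, k, Ω … For some simple sets Ω, e.g. for rectangular parallelepipeds, the inequalities hold
without any restrictions on the points»; p. 575 «A₀ = A(Mj)», «c′ = dMc»; p. 581 (Lemma 2.2's collar).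

WHAT THIS MODULE PROVES.  **`thm110_deriv_box_uniform`** — THEOREM (1.10), derivative member, on a box, HYPOTHESIS-FREE:
`∃ K` (`8 ≤ K`, `4 ∣ K`), `∃ c₁ > 0`, `∀ (c, β)` `∃ e₁ > 0` — BEFORE the box — such that for every `k ≥ 1`, `(a, m²)` in
the window, EVERY box `Ω = Π[0, nMb_μ)` with `K ∣ Mb_μ`, every component field `A` (1.7)-regular on `Ω` with
`0 < e ≤ e₁` and `A = A(0)` on the collar of width `K` at `∂Ω`, every forward bond `⟨x, x+e_μ⟩ ⊂ Ω`, every `f` supported at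
sup-distance `≥ D` from `x`: `|(D^η_{A,μ}G_k(Ω,A)f)(x)_i| ≤ c₁·e^{−D/K}·‖f‖_∞`, the constant UNIFORM IN `η` and the
threshold UNIFORM IN `Ω` (p17 g4's `B4Thm110BoxDerivRegular.thm110_deriv_box_regular` had `e₁ = e₁(c, β, S)`, `S` the
box size).  Interior cubes: p35's `lemma22_sup_cubeField` (.1, .2) / `eq220_cubeField` on the cut cube (side bound `2K`,
base value `A(corner of □_j)`); face cubes: `const_inputs`, `const_inputs_deriv` (`Ã_j` = the constant configuration).
HONEST SCOPE.  Derivative member; forward bond inside `Ω`; `d ≥ 1`; the lineage's (1.6); `A` constant on the collar of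
width `K` at `∂Ω` (HOME/GAPS.md G-B4-p17-02); `ℓ^∞` over sites and colours.  No `def`, no `Prop` fact, no `sorry`; axioms
standard.
-/

namespace Literature.MathematicalPhysics.QuantumFieldTheory.Balaban1983to89.B4Thm110BoxDerivUniform

open Literature.MathematicalPhysics.QuantumFieldTheory.Balaban1983to89.B4Reflection242 (boxDom mem_boxDom nbrs mem_nbrs blk)
open Literature.MathematicalPhysics.QuantumFieldTheory.Balaban1983to89.B4GaugeCovariance
open Literature.MathematicalPhysics.QuantumFieldTheory.Balaban1983to89.B4Commutators25to211 (mulH opK)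
open Literature.MathematicalPhysics.QuantumFieldTheory.Balaban1983to89.B4Lower18Regular (e1 baseEmb stairContour)
open Literature.MathematicalPhysics.QuantumFieldTheory.Balaban1983to89.B4Lower18RegularRegion (compField)
open Literature.MathematicalPhysics.QuantumFieldTheory.Balaban1983to89.B4Lemma22ReduceZero (Box opA greenA derivA)
open Literature.MathematicalPhysics.QuantumFieldTheory.Balaban1983to89.B4Lemma22Reduce231 (supN supN_nonneg)
open Literature.MathematicalPhysics.QuantumFieldTheory.Balaban1983to89.B4PartitionUnity22 (hprof D1 D2 D1_nonneg D2_nonneg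
  contDiff_hprof hasCompactSupport_hprof)
open Literature.MathematicalPhysics.QuantumFieldTheory.Balaban1983to89.B4Eq220PartitionSizes (hBox)
open Literature.MathematicalPhysics.QuantumFieldTheory.Balaban1983to89.B4Eq220CommutatorField (kOp)
open Literature.MathematicalPhysics.QuantumFieldTheory.Balaban1983to89.B4CubeFields22 (cubeField)
open Literature.MathematicalPhysics.QuantumFieldTheory.Balaban1983to89.B4Eq220CubeField (eq220_cubeField
  lemma22_sup_cubeField)
open Literature.MathematicalPhysics.QuantumFieldTheory.Balaban1983to89.B4BoxCubeGeometry (posR cubeLo cubeMs cube_ho)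
open Literature.MathematicalPhysics.QuantumFieldTheory.Balaban1983to89.B4Thm110BoxRegular (const_inputs greenA_congr_bonds
  kOp_congr_bonds)
open Literature.MathematicalPhysics.QuantumFieldTheory.Balaban1983to89.B4Thm110BoxDerivRegular (const_inputs_deriv
  derivA_congr_bonds)
open Literature.MathematicalPhysics.QuantumFieldTheory.Balaban1983to89.B4Thm110BoxCut
open Literature.MathematicalPhysics.QuantumFieldTheory.Balaban1983to89.B4Thm110BoxUniform (IsInt baseVal baseVal_of_isInt
  baseVal_of_not_isInt regular_shift face_const)
open Literature.MathematicalPhysics.QuantumFieldTheory.Balaban1983to89.B4Thm110BoxDerivCut (thm110_deriv_boxCut_cubeField)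
open scoped Matrix

noncomputable section

variable {d : ℕ}
variable {ι : Type} [Fintype ι] [DecidableEq ι]

/-- **THEOREM (1.10) OF [B4] ON A BOX, DERIVATIVE MEMBER — FOR A (1.7)-REGULAR FIELD CONSTANT NEAR `∂Ω`, WITH
«e SUFFICIENTLY SMALL» UNIFORM IN `Ω`** (pp.573–579, p.581; the print's cut cubes): there are `K` (`8 ≤ K`, `4 ∣ K`) and
`c₁ > 0` (structure group data, `d`, `L`, window) such that for all `c ≥ 0`, `β > 0` there is `e₁ > 0` with — for every
`k ≥ 1`, `(a,m²) ∈ [a₋,a₊]×[0,m²₊]`, EVERY box `Ω = Π[0, nMb_μ)` with `K ∣ Mb_μ`, `1 ≤ Mb_μ`, component field `A` with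
`|A_ν(x+e_μ) − A_ν(x)| ≤ c·e^{β−1}η` on `Ω`, `0 < e ≤ e₁`, `A = A(0)` on the collar of width `K` at `∂Ω`, every `μ` and
`x` with `x + e_μ ∈ Ω`, every set `P` with `|x/n − x′/n|_∞ ≥ D` on `P`, every `f` supported in `P` with `|f| ≤ φ` —
`|(D^η_{A,μ}G_k(Ω,A)f)(x)_i| ≤ c₁·e^{−D/K}·φ`. [cite: Balaban1983RegularityDecay, Theorem (1.10) p.573; pp.575–579, p.581] -/
theorem thm110_deriv_box_uniform (F : OrthFlow ι) {ℓ₁ : ℝ} (hℓ₁ : 0 ≤ ℓ₁)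
    (hLip : ∀ t (v : ι → ℝ), ((F.U t - 1) *ᵥ v) ⬝ᵥ ((F.U t - 1) *ᵥ v) ≤ (ℓ₁ * t) ^ 2 * (v ⬝ᵥ v))
    (d ℓ : ℕ) (hd : 1 ≤ d) (hℓ : 1 ≤ ℓ) (amin aplus m2plus : ℝ) (ha : 0 < amin) :
    ∃ K : ℕ, 8 ≤ K ∧ 4 ∣ K ∧ ∃ c₁ : ℝ, 0 < c₁ ∧ ∀ (creg β : ℝ), 0 ≤ creg → 0 < β →
      ∃ e₁ : ℝ, 0 < e₁ ∧ ∀ (k : ℕ), 1 ≤ k → ∀ (hn : 1 ≤ (ℓ + 1) ^ k) (a m2 : ℝ),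
      amin ≤ a → a ≤ aplus → 0 ≤ m2 → m2 ≤ m2plus →
      ∀ (Mb : Fin (d + 1) → ℕ), (∀ i, 1 ≤ Mb i) → (∀ μ, K ∣ Mb μ) →
      ∀ (Ac : (Fin (d + 1) → ℤ) → Fin (d + 1) → ℝ) (e : ℝ), 0 < e → e ≤ e₁ →
        (∀ x ∈ Box d ℓ k Mb, ∀ μ ν : Fin (d + 1),
          |Ac (x + e1 μ) ν - Ac x ν| ≤ creg * e ^ (β - 1) / ((ℓ + 1) ^ k : ℕ)) →
        (∀ w ∈ Box d ℓ k Mb, (∃ μ, w μ < (((ℓ + 1) ^ k : ℕ) : ℤ) * K ∨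
            (((ℓ + 1) ^ k : ℕ) : ℤ) * Mb μ < w μ + (((ℓ + 1) ^ k : ℕ) : ℤ) * K) → ∀ ν, Ac w ν = Ac 0 ν) →
      ∀ (μ : Fin (d + 1)) (x : ↥(Box d ℓ k Mb)), x.1 + e1 μ ∈ Box d ℓ k Mb →
      ∀ (P : ↥(Box d ℓ k Mb) → Prop) [DecidablePred P] (D : ℝ),
        (∀ x', P x' → ∃ ν, D ≤ |posR ℓ k Mb x ν - posR ℓ k Mb x' ν|) →
      ∀ (f : ↥(Box d ℓ k Mb) × ι → ℝ), (∀ p, ¬ P p.1 → f p = 0) → ∀ (φ : ℝ), 0 ≤ φ → (∀ p, |f p| ≤ φ) →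
      ∀ i : ι,
        |(derivA d F (e / ((ℓ + 1) ^ k : ℕ)) ℓ k Mb (fun u v : ↥(Box d ℓ k Mb) => compField Ac u.1 v.1) μ
            *ᵥ (greenA d F (e / ((ℓ + 1) ^ k : ℕ)) ℓ k a m2 Mb (baseEmb hn Mb) (stairContour hn Mb)
                (fun u v : ↥(Box d ℓ k Mb) => compField Ac u.1 v.1) *ᵥ f)) (x, i)|
          ≤ c₁ * Real.exp (-(D / K)) * φ := by
  obtain ⟨C₁, hC₁, h₁⟩ := lemma22_sup_cubeField F hℓ₁ hLip d ℓ hℓ amin aplus m2plus ha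
  obtain ⟨C₂, hC₂, h₂⟩ := eq220_cubeField F hℓ₁ hLip d ℓ hℓ amin aplus m2plus ha
  obtain ⟨cG₀, cK₀, hcG₀, hcK₀, h₀⟩ := const_inputs F hℓ₁ hLip d ℓ hℓ amin aplus m2plus ha
  obtain ⟨cD₀, hcD₀, h₀'⟩ := const_inputs_deriv F d ℓ hℓ amin aplus m2plus ha
  set X : ℝ := (3 : ℝ) ^ (d + 1) * Real.sqrt (Fintype.card ι) * (C₂ + cK₀) * Real.exp 1 with hX
  have hX0 : 0 ≤ X := by positivity
  set K : ℕ := 8 * (⌈X⌉₊ + 1) with hK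
  have hK8 : 8 ≤ K := by omega
  have h4 : 4 ∣ K := ⟨2 * (⌈X⌉₊ + 1), by omega⟩
  have hK2 : 2 ≤ K := by omega
  have hK1 : 1 ≤ K := by omega
  have hKr : (0 : ℝ) < K := by exact_mod_cast hK1
  have hKX : X ≤ K := by
    refine (Nat.le_ceil X).trans ?_
    rw [hK]
    push_cast
    linarith [(Nat.cast_nonneg ⌈X⌉₊ : (0 : ℝ) ≤ ⌈X⌉₊)]
  set cG : ℝ := max C₁ cG₀ with hcG_def
  set cD : ℝ := max C₁ cD₀ with hcD_def
  set cK : ℝ := (C₂ + cK₀) / K with hcK_def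
  have hcG : 0 ≤ cG := hC₁.le.trans (le_max_left _ _)
  have hcD : 0 ≤ cD := hC₁.le.trans (le_max_left _ _)
  have hcK : 0 ≤ cK := div_nonneg (by positivity) hKr.le
  have hs0 : 0 ≤ ((d : ℝ) + 1) * (D1 hprof + D2 hprof) := by
    have := D1_nonneg contDiff_hprof hasCompactSupport_hprof
    have := D2_nonneg contDiff_hprof hasCompactSupport_hprof
    positivity
  have h3 : (3 : ℝ) ^ (d + 1) * (Real.sqrt (Fintype.card ι) * cK) ≤ Real.exp (-1) := by
    have hexp : Real.exp 1 * Real.exp (-1) = 1 := by rw [← Real.exp_add]; norm_num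
    have e : (3 : ℝ) ^ (d + 1) * (Real.sqrt (Fintype.card ι) * cK) = X / K * Real.exp (-1) := by
      rw [hcK_def, hX]
      calc (3 : ℝ) ^ (d + 1) * (Real.sqrt (Fintype.card ι) * ((C₂ + cK₀) / K))
          = (3 : ℝ) ^ (d + 1) * Real.sqrt (Fintype.card ι) * (C₂ + cK₀) / K * (Real.exp 1 * Real.exp (-1)) := by
            rw [hexp]; ring
        _ = (3 : ℝ) ^ (d + 1) * Real.sqrt (Fintype.card ι) * (C₂ + cK₀) * Real.exp 1 / K * Real.exp (-1) := by
            ring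
    rw [e]
    have : X / K ≤ 1 := div_le_one_of_le₀ hKX (Nat.cast_nonneg K)
    calc X / K * Real.exp (-1) ≤ 1 * Real.exp (-1) := mul_le_mul_of_nonneg_right this (Real.exp_pos _).le
      _ = Real.exp (-1) := one_mul _
  set αP : ℝ := Real.sqrt (Fintype.card ι) * cD
    + ((d : ℝ) + 1) * (D1 hprof + D2 hprof) / K
        * ((Fintype.card ι : ℝ) * (Real.sqrt (Fintype.card ι) * cG)) with hαP
  set c₁ : ℝ := 2 ^ (d + 3) * Real.exp (19 / 8) * αP + 1 with hc₁
  refine ⟨K, hK8, h4, c₁, by positivity, fun creg β hcreg hβ => ?_⟩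
  obtain ⟨e₁, he₁, h₁'⟩ := h₁ creg β hcreg hβ (2 * K) K hK1
  obtain ⟨e₂, he₂, h₂'⟩ := h₂ creg β hcreg hβ (2 * K) K hK2
  refine ⟨min e₁ e₂, lt_min he₁ he₂, ?_⟩
  intro k hk hn a m2 ea1 ea2 em1 em2 Mb hM hKM Ac e he hle h17 hcol μ x hxμ P _ D hD f hfP φ hφ hf i
  have hn2 : 2 ≤ (ℓ + 1) ^ k := by
    calc 2 ≤ ℓ + 1 := by omega
      _ = (ℓ + 1) ^ 1 := (pow_one _).symm
      _ ≤ (ℓ + 1) ^ k := Nat.pow_le_pow_right (Nat.succ_pos ℓ) hk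
  have hnK : 16 ≤ (ℓ + 1) ^ k * K := by nlinarith
  have ha' : 0 < a := lt_of_lt_of_le ha ea1
  have hcol' : ∀ w : ↥(Box d ℓ k Mb), (∃ μ, w.1 μ < (((ℓ + 1) ^ k : ℕ) : ℤ) * K ∨
      (((ℓ + 1) ^ k : ℕ) : ℤ) * Mb μ < w.1 μ + (((ℓ + 1) ^ k : ℕ) : ℤ) * K) → ∀ ν, Ac w.1 ν = Ac 0 ν :=
    fun w hw => hcol w.1 w.2 hw
  set AcS : (Fin (d + 1) → ℤ) → (Fin (d + 1) → ℤ) → Fin (d + 1) → ℝ :=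
    fun j y => Ac (y + fun i => (((ℓ + 1) ^ k : ℕ) : ℤ) * (cubeLo Mb K j i : ℤ)) with hAcS
  have hregS : ∀ j, ∀ y ∈ Box d ℓ k (cubeMs Mb K j), ∀ μ ν : Fin (d + 1),
      |AcS j (y + e1 μ) ν - AcS j y ν| ≤ creg * e ^ (β - 1) / ((ℓ + 1) ^ k : ℕ) :=
    fun j => regular_shift (Mb := Mb) (K := K) j h17
  have hbase : ∀ j, IsInt Mb K j → baseVal Mb K ((ℓ + 1) ^ k) Ac j = AcS j 0 := fun j hj => by
    rw [baseVal_of_isInt _ _ hj]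
  have hMs1 : ∀ j ∈ labelsK Mb K, ∀ μ, 1 ≤ cubeMs Mb K j μ := fun j hj μ => one_le_cubeMs hK1 hKM hM hj μ
  have hMsS : ∀ j ∈ labelsK Mb K, ∀ μ, cubeMs Mb K j μ ≤ 2 * K := fun j hj μ => cubeMs_le hK1 hKM hM hj μ
  have hMsK : ∀ j ∈ labelsK Mb K, ∀ μ, K ∣ cubeMs Mb K j μ := fun j hj μ => dvd_cubeMs hK1 hKM hM hj μ
  -- the per-cube inputs on the cut cubes
  have hG : ∀ j ∈ labelsK Mb K, ∀ Φ : ↥(Box d ℓ k (cubeMs Mb K j)) × ι → ℝ,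
      supN (greenA d F (e / ((ℓ + 1) ^ k : ℕ)) ℓ k a m2 (cubeMs Mb K j) (baseEmb hn _) (stairContour hn _)
          (cubeField (Box d ℓ k (cubeMs Mb K j)) ((ℓ + 1) ^ k) K (jloc j) (baseVal Mb K ((ℓ + 1) ^ k) Ac j)
            (AcS j)) *ᵥ Φ) ≤ cG * supN Φ := by
    intro j hj Φ
    by_cases hint : IsInt Mb K j
    · have hin := fun μ => cubeMs_interior hK1 hKM hM hj hint μ
      rw [hbase j hint]
      have hb := (h₁' k hk hn hnK a m2 ea1 ea2 em1 em2 (cubeMs Mb K j) (hMs1 j hj) (hMsS j hj) (jloc j)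
        (fun μ => by rw [(hin μ).2]) (fun μ => by rw [(hin μ).1, (hin μ).2]; push_cast; omega)
        (AcS j) e he (hle.trans (min_le_left _ _)) (hregS j) Φ).1
      exact hb.trans (mul_le_mul_of_nonneg_right (le_max_left _ _) (supN_nonneg Φ))
    · rw [baseVal_of_not_isInt _ _ hint,
        greenA_congr_bonds F _ hn a m2 (cubeMs Mb K j) (face_const hK1 hKM Ac hj hint hcol')]
      exact ((h₀ k hk hn a m2 ea1 ea2 em1 em2 (cubeMs Mb K j) (hMs1 j hj) K (jloc j) hK2 (hMsK j hj) _ (Ac 0)).1 Φ).trans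
        (mul_le_mul_of_nonneg_right (le_max_right _ _) (supN_nonneg Φ))
  have hDG : ∀ j ∈ labelsK Mb K, ∀ Φ : ↥(Box d ℓ k (cubeMs Mb K j)) × ι → ℝ,
      supN (derivA d F (e / ((ℓ + 1) ^ k : ℕ)) ℓ k (cubeMs Mb K j)
          (cubeField (Box d ℓ k (cubeMs Mb K j)) ((ℓ + 1) ^ k) K (jloc j) (baseVal Mb K ((ℓ + 1) ^ k) Ac j)
            (AcS j)) μ
        *ᵥ (greenA d F (e / ((ℓ + 1) ^ k : ℕ)) ℓ k a m2 (cubeMs Mb K j) (baseEmb hn _) (stairContour hn _)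
          (cubeField (Box d ℓ k (cubeMs Mb K j)) ((ℓ + 1) ^ k) K (jloc j) (baseVal Mb K ((ℓ + 1) ^ k) Ac j)
            (AcS j)) *ᵥ Φ)) ≤ cD * supN Φ := by
    intro j hj Φ
    by_cases hint : IsInt Mb K j
    · have hin := fun μ => cubeMs_interior hK1 hKM hM hj hint μ
      rw [hbase j hint]
      have hb := (h₁' k hk hn hnK a m2 ea1 ea2 em1 em2 (cubeMs Mb K j) (hMs1 j hj) (hMsS j hj) (jloc j)
        (fun μ => by rw [(hin μ).2]) (fun μ => by rw [(hin μ).1, (hin μ).2]; push_cast; omega)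
        (AcS j) e he (hle.trans (min_le_left _ _)) (hregS j) Φ).2 μ
      exact hb.trans (mul_le_mul_of_nonneg_right (le_max_left _ _) (supN_nonneg Φ))
    · have hb := face_const (ℓ := ℓ) (k := k) hK1 hKM Ac hj hint hcol'
      rw [baseVal_of_not_isInt _ _ hint, derivA_congr_bonds F _ (cubeMs Mb K j) hb μ,
        greenA_congr_bonds F _ hn a m2 (cubeMs Mb K j) hb]
      exact (h₀' k hk hn a m2 ea1 ea2 em1 em2 (cubeMs Mb K j) (hMs1 j hj) _ (Ac 0) μ Φ).trans
        (mul_le_mul_of_nonneg_right (le_max_right _ _) (supN_nonneg Φ))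
  have hKG : ∀ j ∈ labelsK Mb K, ∀ Φ : ↥(Box d ℓ k (cubeMs Mb K j)) × ι → ℝ,
      supN (kOp F (e / ((ℓ + 1) ^ k : ℕ)) ((ℓ + 1) ^ k) (B1.aSeq a ((ℓ : ℝ) + 1) k) m2 (cubeMs Mb K j)
            (baseEmb hn _) (stairContour hn _)
            (cubeField (Box d ℓ k (cubeMs Mb K j)) ((ℓ + 1) ^ k) K (jloc j) (baseVal Mb K ((ℓ + 1) ^ k) Ac j) (AcS j))
            (hBox ((ℓ + 1) ^ k) K (cubeMs Mb K j) (jloc j))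
          *ᵥ (greenA d F (e / ((ℓ + 1) ^ k : ℕ)) ℓ k a m2 (cubeMs Mb K j) (baseEmb hn _) (stairContour hn _)
              (cubeField (Box d ℓ k (cubeMs Mb K j)) ((ℓ + 1) ^ k) K (jloc j) (baseVal Mb K ((ℓ + 1) ^ k) Ac j)
                (AcS j))
            *ᵥ (mulH (ι := ι) (hBox ((ℓ + 1) ^ k) K (cubeMs Mb K j) (jloc j)) *ᵥ Φ))) ≤ cK * supN Φ := by
    intro j hj Φ
    have hsplit : ∀ t : ℝ, 0 ≤ t → t ≤ C₂ + cK₀ → t / K * supN Φ ≤ cK * supN Φ := fun t _ ht =>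
      mul_le_mul_of_nonneg_right (div_le_div_of_nonneg_right ht hKr.le) (supN_nonneg Φ)
    by_cases hint : IsInt Mb K j
    · have hin := fun μ => cubeMs_interior hK1 hKM hM hj hint μ
      rw [hbase j hint]
      have hb := h₂' k hk hn hnK a m2 ea1 ea2 em1 em2 (cubeMs Mb K j) (hMs1 j hj) (hMsS j hj) (hMsK j hj) (jloc j)
        (fun μ => by rw [(hin μ).2]) (fun μ => by rw [(hin μ).1, (hin μ).2]; push_cast; omega)
        (AcS j) e he (hle.trans (min_le_right _ _)) (hregS j) Φ
      exact hb.trans (hsplit C₂ hC₂.le (by linarith))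
    · have hb := face_const (ℓ := ℓ) (k := k) hK1 hKM Ac hj hint hcol'
      rw [baseVal_of_not_isInt _ _ hint, kOp_congr_bonds F _ hn a m2 (cubeMs Mb K j) hb,
        greenA_congr_bonds F _ hn a m2 (cubeMs Mb K j) hb]
      exact ((h₀ k hk hn a m2 ea1 ea2 em1 em2 (cubeMs Mb K j) (hMs1 j hj) K (jloc j) hK2 (hMsK j hj) _ (Ac 0)).2 Φ).trans
        (hsplit cK₀ hcK₀.le (by linarith))
  have main := thm110_deriv_boxCut_cubeField F hℓ hk hn hd Mb hM hK8 h4 hKM ha' em1 e Ac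
    (baseVal Mb K ((ℓ + 1) ^ k) Ac) hcG hcD hcK hG μ hDG hKG h3 x hxμ P hD f hfP hφ hf i
  refine main.trans (mul_le_mul_of_nonneg_right (mul_le_mul_of_nonneg_right ?_ (Real.exp_pos _).le) hφ)
  rw [hc₁]
  linarith

end

end Literature.MathematicalPhysics.QuantumFieldTheory.Balaban1983to89.B4Thm110BoxDerivUniform
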